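import Summits.KontsevichZagierPeriods.KontsevichZagierPeriods.Theorems.RootDecompQuadraticDescentPair18HomotopyAngP08

/-! # `RootDecompQuadraticDescentPair18HomotopyAngP09` — part 9/20 of the mechanical ≤400-line split of `Pair18HomotopyAng_v13_landing.lean` (sha256 01bf0af4c8d09f43…)
Source: decomp-kz lens-6 g9 `Pair18HomotopyAng.lean` v13 (HOME/decomp-kz-lens-6/g9/, sha256 bd7fcda1…; critic g5 19:35:56Z CLEARED «angle side of #18 PROVED»: hTh7_holds, hB17_holds, hAng4_holds with no hypotheses) — companion file #2 of Pair18Homotopy v14 (landed as …Pair18HomotopyP01–P31): the verbatim COPIED PRELUDE is dropped in favour of those landed declarations, the four homonyms with different bodies are renamed (Th7_eq', TriA, isSemialgebraic_TriA, volume_diag'), `#print axioms` pins removed.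
Split by census-1 g9 `gen/splitlean.py`: scopes re-opened with their `open`/`variable`/`set_option` context; mathematics and declaration order unchanged. -/

set_option linter.unusedSimpArgs false
noncomputable section
open _root_.Set MvPolynomial
namespace Summit.KontsevichZagierPeriods.RootDecompQuadraticDescent.Pair18Homotopy
open Literature.NumberTheory.Transcendental
open Literature.NumberTheory.Transcendental.KZ (RFun cube)
open Summit.KontsevichZagierPeriods.RootDecompQuadraticDescent.DarkPairs (rel_reflect_rep rel_double)
section Fold
open Literature.ModelTheory.ExponentialFields (IsSemialgebraic isSemialgebraic_setOf_eval_le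
  isSemialgebraic_setOf_eval_pos isSemialgebraic_setOf_eval_nonneg isSemialgebraic_setOf_eval_eq_zero)

open _root_.Set MvPolynomial in
open Literature.NumberTheory.Transcendental in
open Literature.NumberTheory.Transcendental.KZ (RFun cube) in
open Summit.KontsevichZagierPeriods.RootDecompQuadraticDescent.DarkPairs (rel_reflect_rep rel_double) in
/-- Auxiliary step `cube2` (§0): cube2. [bookkeeping] -/
private theorem cube2 {x : Fin 2 → ℝ} (hx : x ∈ KZ.cube 2) : (0 ≤ x 0 ∧ x 0 ≤ 1) ∧ (0 ≤ x 1 ∧ x 1 ≤ 1) := ⟨hx 0, hx 1⟩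

/-- Modulo KZ-relations,
`[AngH|RM] + [AngH|RK₊] + [AngH|RK₋] ≡ [AngH|RM⁻] + [AngH|RM_rect] + [AngH|Trap'_lo] + [AngH|Trap'_hi] + [AngH|Ũ₋']
 + [AngH|S'_hi] + [AngH|U₊' ∩ {7P'² ≥ 1}] + [AngH|RM_cap' ∩ {v' ≤ φ'}]`. -/
theorem hAng4_cells2 :
    KZ.of AngHM + KZ.of AngHp + KZ.of AngHm
      - KZ.of AngHMneg - KZ.of AngHMrect - KZ.of AngHTrapLo - KZ.of AngHTrapHi - KZ.of AngHUmr
      - KZ.of AngHSHi - KZ.of AngHUphi - KZ.of AngHMcapD ∈ KZ.relations := by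
  have h := sub_mem (sub_mem (sub_mem (add_mem hAng4_cells AngHMcapI_cut) AngHSHi_cut) AngHSHiB_UMhi)
    AngHSHiA_RMcapU
  convert h using 1
  abel

/-! ### §19k  hAng4 bookkeeping, third cells: the lower polygon
`S'_lo = {α₁ ≤ φ' ≤ θ−α₁, φ'−α₁ ≤ v' ≤ φ'} = (U₊' ∩ {7P'² ≥ 1}) ⊔ (RM_cap' ∩ {v' ≤ φ'})`

The non-trivial inclusion is `curve_above_line` (`κ'(φ') ≥ θ−2α₁ ≥ φ'−α₁`, tight at `(θ−α₁, θ−2α₁)`), proved by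
concavity of `f(q) = (1+pq)² − 7(p−q)²` in `q` and the factorisation `(x−1)(9−x)(x+7)²` at the curve point.  With it,
ALL curve-bounded cells are gone: `hAng4_polygons`. -/

/-- `κ'(φ') ≥ θ − 2α₁ ≥ φ' − α₁` on `[α₁, θ−α₁]` in tangent form. -/
theorem curve_above_line (p q : ℝ) (hp : 0 ≤ p) (h7 : 1 ≤ 7 * (p * p)) (h9 : 7 * (p * p) ≤ 9) (hq : 0 ≤ q)
    (hqp : q ≤ p) (h4 : 1 ≤ q * q * (1 + 2 * (p * p))) :
    7 * ((p - q) * (p - q)) ≤ (1 + p * q) * (1 + p * q) := by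
  -- `s = √(1+2p²)`, `q₀ = 1/s` is the curve point; the target `f(q) = (p²−7)q² + 16pq + 1 − 7p²` is concave in `q`.
  set s : ℝ := Real.sqrt (1 + 2 * (p * p)) with hs_def
  have hs2 : s * s = 1 + 2 * (p * p) := Real.mul_self_sqrt (by nlinarith [mul_self_nonneg p])
  have hs0 : 0 < s := Real.sqrt_pos.2 (by nlinarith [mul_self_nonneg p])
  -- (1) one-variable inequality at the curve point: `(14p⁴+4p²+6)² ≤ 256 p² (1+2p²)`,
  --     i.e. `49·(rhs − lhs)/4 = (x−1)(9−x)(x+7)²`, `x = 7p²`.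
  have h1d : (14 * (p * p) * (p * p) + 4 * (p * p) + 6) * (14 * (p * p) * (p * p) + 4 * (p * p) + 6) ≤
      256 * (p * p) * (1 + 2 * (p * p)) := by
    nlinarith [mul_nonneg (mul_nonneg (sub_nonneg.2 h7) (sub_nonneg.2 h9))
      (mul_self_nonneg (7 * (p * p) + 7))]
  have hM0 : 0 ≤ 14 * (p * p) * (p * p) + 4 * (p * p) + 6 := by positivity
  have hps0 : 0 ≤ 16 * p * s := by positivity
  -- (2) hence `16 p s ≥ 14p⁴ + 4p² + 6`
  have h2 : 14 * (p * p) * (p * p) + 4 * (p * p) + 6 ≤ 16 * p * s := by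
    by_contra hlt
    push Not at hlt
    have hA : 0 < (14 * (p * p) * (p * p) + 4 * (p * p) + 6) - 16 * p * s := by linarith
    have hB : 0 < (14 * (p * p) * (p * p) + 4 * (p * p) + 6) + 16 * p * s := by linarith
    have hAB := mul_pos hA hB
    nlinarith [hAB, hs2, h1d]
  -- (3) `F₀ = s²·f(1/s) = (p²−7) + 16ps + (1−7p²)s² ≥ 0`
  have hF0 : 0 ≤ (p * p - 7) + 16 * p * s + (1 - 7 * (p * p)) * (s * s) := by
    rw [hs2]; nlinarith [h2]
  -- (4) `q s ≥ 1`
  have hqs : 1 ≤ q * s := by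
    have hsq : 1 ≤ (q * s) * (q * s) := by nlinarith [hs2, h4]
    have hqs0 : 0 ≤ q * s := mul_nonneg hq hs0.le
    nlinarith [hsq, hqs0]
  have hps : 1 ≤ p * s := le_trans hqs (by nlinarith [mul_le_mul_of_nonneg_right hqp hs0.le])
  have hfp : 0 ≤ (1 + p * p) * (1 + p * p) := mul_self_nonneg _
  -- (5) chord identity for the concave quadratic `f`:
  --   `f(q)·(ps−1)·s = (p−q)·F₀ + (qs−1)·s·f(p) − (p²−7)(qs−1)(p−q)(ps−1)`
  have key : ((1 + p * q) * (1 + p * q) - 7 * ((p - q) * (p - q))) * ((p * s - 1) * s) =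
      (p - q) * ((p * p - 7) + 16 * p * s + (1 - 7 * (p * p)) * (s * s)) +
        (q * s - 1) * s * ((1 + p * p) * (1 + p * p)) +
        (7 - p * p) * ((q * s - 1) * (p - q) * (p * s - 1)) := by
    ring
  have hR : 0 ≤ (p - q) * ((p * p - 7) + 16 * p * s + (1 - 7 * (p * p)) * (s * s)) +
        (q * s - 1) * s * ((1 + p * p) * (1 + p * p)) +
        (7 - p * p) * ((q * s - 1) * (p - q) * (p * s - 1)) := by
    have t1 := mul_nonneg (sub_nonneg.2 hqp) hF0
    have t2 := mul_nonneg (mul_nonneg (sub_nonneg.2 hqs) hs0.le) hfp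
    have t3 := mul_nonneg (by nlinarith : (0:ℝ) ≤ 7 - p * p)
      (mul_nonneg (mul_nonneg (sub_nonneg.2 hqs) (sub_nonneg.2 hqp)) (sub_nonneg.2 hps))
    linarith
  rcases eq_or_lt_of_le hps with heq | hlt
  · -- `ps = 1` forces `qs = 1`, `q = p`
    have hq1 : q * s = 1 := le_antisymm (by nlinarith [mul_le_mul_of_nonneg_right hqp hs0.le]) hqs
    have hqp' : q = p := by
      have : (p - q) * s = 0 := by nlinarith
      rcases mul_eq_zero.1 this with h | h
      · linarith
      · exact absurd h hs0.ne'
    subst hqp'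
    nlinarith [mul_self_nonneg q]
  · have hpos : 0 < (p * s - 1) * s := mul_pos (by linarith) hs0
    by_contra hcon
    push Not at hcon
    have : ((1 + p * q) * (1 + p * q) - 7 * ((p - q) * (p - q))) * ((p * s - 1) * s) < 0 :=
      mul_neg_of_neg_of_pos (by linarith) hpos
    linarith [key]

/-- `S'_lo = {1 ≤ 7P'² ≤ 9, 0 ≤ Q' ≤ P', 7(P'−Q')² ≤ (1+P'Q')², Q' ≤ 1}`. -/
def SLo : Set (Fin 2 → ℝ) := cube 2 ∩ (sRM1 ∩ sRM2 ∩ sU1 ∩ sU2 ∩ sU3 ∩ sI3)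
/-- Auxiliary step `isSemialgebraic_SLo` (§19k): is Semialgebraic SLo. [bookkeeping] -/
theorem isSemialgebraic_SLo : IsSemialgebraic ℚ SLo := by
  refine KZ.isSemialgebraic_cube.inter ((((((?_ : IsSemialgebraic ℚ sRM1).inter ?_).inter ?_).inter ?_).inter
    ?_).inter ?_)
  · exact isSemialgebraic_of_le (C 1) (C 28 * X 0 * X 0) sRM1 fun z => by
      simp only [sRM1, mem_setOf_eq, map_mul, aeval_C, aeval_X, eq_ratCast, Rat.cast_ofNat, Rat.cast_one]
  · exact isSemialgebraic_of_le (C 28 * X 0 * X 0) (C 9) sRM2 fun z => by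
      simp only [sRM2, mem_setOf_eq, map_mul, aeval_C, aeval_X, eq_ratCast, Rat.cast_ofNat]
  · exact isSemialgebraic_of_le (C 2) (C 4 * X 1) sU1 fun z => by
      simp only [sU1, mem_setOf_eq, map_mul, aeval_C, aeval_X, eq_ratCast, Rat.cast_ofNat]
  · exact isSemialgebraic_of_le (C 4 * X 1 - C 2) (C 2 * X 0) sU2 fun z => by
      simp only [sU2, mem_setOf_eq, map_mul, map_sub, aeval_C, aeval_X, eq_ratCast, Rat.cast_ofNat]
  · exact isSemialgebraic_of_le (C 7 * ((C 2 * X 0 - (C 4 * X 1 - C 2)) * (C 2 * X 0 - (C 4 * X 1 - C 2))))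
      ((C 1 + C 2 * X 0 * (C 4 * X 1 - C 2)) * (C 1 + C 2 * X 0 * (C 4 * X 1 - C 2))) sU3 fun z => by
      simp only [sU3, mem_setOf_eq, map_mul, map_sub, map_add, aeval_C, aeval_X, eq_ratCast, Rat.cast_ofNat,
        Rat.cast_one]
  · exact isSemialgebraic_of_le (C 7 * ((C 4 * X 1 - C 2) * (C 4 * X 1 - C 2))) (C 9) sI3 fun z => by
      simp only [sI3, mem_setOf_eq, map_mul, map_sub, aeval_C, aeval_X, eq_ratCast, Rat.cast_ofNat]
/-- Auxiliary definition `SLoB` (§19k): SLo B. [bookkeeping] -/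
def SLoB : Set (Fin 2 → ℝ) := SLo ∩ sU4
/-- Auxiliary definition `SLoA` (§19k): SLo A. [bookkeeping] -/
def SLoA : Set (Fin 2 → ℝ) := SLo ∩ sU4c
/-- Auxiliary definition `AngHSLo` (§19k): Ang HSLo. [bookkeeping] -/
def AngHSLo : KZ.IntegralRep 2 := AngH.rep.restrict SLo isSemialgebraic_SLo (fun _ hz => hz.1)
/-- Auxiliary definition `AngHSLoB` (§19k): Ang HSLo B. [bookkeeping] -/
def AngHSLoB : KZ.IntegralRep 2 :=
  AngH.rep.restrict SLoB (isSemialgebraic_SLo.inter isSemialgebraic_sU4) (fun _ hz => hz.1.1)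
/-- Auxiliary definition `AngHSLoA` (§19k): Ang HSLo A. [bookkeeping] -/
def AngHSLoA : KZ.IntegralRep 2 :=
  AngH.rep.restrict SLoA (isSemialgebraic_SLo.inter isSemialgebraic_sU4c) (fun _ hz => hz.1.1)

/-- the curve cut `[AngH | S'_lo] ≡ [AngH | S'_lo ∩ {below}] + [AngH | S'_lo ∩ {above}]`. -/
theorem AngHSLo_cut : KZ.of AngHSLo - KZ.of AngHSLoB - KZ.of AngHSLoA ∈ KZ.relations :=
  rel_cut AngHSLo AngHSLoB AngHSLoA (fun z => (4 * z 1 - 2) * (4 * z 1 - 2) * (1 + 8 * z 0 * z 0)) 1 rfl rfl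
    volume_curve (fun _ _ => rfl) (fun _ _ => rfl)

/-- `S'_lo ∩ {below the curve} = U₊' ∩ {7P'² ≥ 1}`. -/
theorem SLoB_eq_UPhi : SLoB = UPhi := by
  ext z
  constructor
  · rintro ⟨⟨hc, ⟨⟨⟨⟨⟨r1, r2⟩, u1⟩, u2⟩, u3⟩, i3⟩⟩, u4⟩
    exact ⟨⟨hc, ⟨⟨⟨⟨u1, u2⟩, u3⟩, u4⟩, r2⟩⟩, r1⟩
  · rintro ⟨⟨hc, ⟨⟨⟨⟨u1, u2⟩, u3⟩, u4⟩, r2⟩⟩, k2⟩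
    have h0 := (cube2 hc).1
    refine ⟨⟨hc, ⟨⟨⟨⟨⟨k2, r2⟩, u1⟩, u2⟩, u3⟩, ?_⟩⟩, u4⟩
    simp only [sU1, sU4, mem_setOf_eq] at u1 u4
    simp only [sI3, mem_setOf_eq]
    have hQ0 : (0:ℝ) ≤ 4 * z 1 - 2 := by linarith
    nlinarith [mul_nonneg (mul_nonneg hQ0 hQ0) (mul_self_nonneg (z 0))]

/-- `S'_lo ∩ {above the curve} = RM_cap' ∩ {Q' ≤ P'}` (uses `curve_above_line`). -/
theorem SLoA_eq_RMcapD : SLoA = RMcapD := by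
  ext z
  constructor
  · rintro ⟨⟨hc, ⟨⟨⟨⟨⟨r1, r2⟩, u1⟩, u2⟩, u3⟩, i3⟩⟩, a4⟩
    simp only [sRM1, sRM2, sU1, sU2, sI3, sU4c, mem_setOf_eq] at r1 r2 u1 u2 i3 a4
    have hQ0 : (0:ℝ) ≤ 4 * z 1 - 2 := by linarith
    refine ⟨⟨hc, ⟨⟨⟨⟨r1, r2⟩, i3⟩, ?_⟩, ?_⟩⟩, ?_⟩
    · simp only [sI4, mem_setOf_eq]; nlinarith [a4]
    · simp only [sI5, mem_setOf_eq]
      nlinarith [mul_nonneg hQ0 hQ0, mul_nonneg (mul_nonneg hQ0 hQ0) (sub_nonneg.2 r2),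
        mul_nonneg (mul_self_nonneg (z 0)) (mul_nonneg hQ0 hQ0)]
    · simp only [sDl, mem_setOf_eq]; linarith
  · rintro ⟨⟨hc, ⟨⟨⟨⟨r1, r2⟩, i3⟩, i4⟩, i5⟩⟩, dl⟩
    have h0 := (cube2 hc).1
    simp only [sRM1, sRM2, sI3, sI4, sI5, sDl, mem_setOf_eq] at r1 r2 i3 i4 i5 dl
    have hp : (0:ℝ) ≤ 2 * z 0 := by linarith [h0.1]
    have hq : (0:ℝ) ≤ 4 * z 1 - 2 := by linarith
    have key := curve_above_line (2 * z 0) (4 * z 1 - 2) hp (by nlinarith [r1]) (by nlinarith [r2]) hq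
      (by linarith) (by nlinarith [i4])
    refine ⟨⟨hc, ⟨⟨⟨⟨⟨r1, r2⟩, ?_⟩, ?_⟩, ?_⟩, i3⟩⟩, ?_⟩
    · simp only [sU1, mem_setOf_eq]; linarith
    · simp only [sU2, mem_setOf_eq]; linarith
    · simp only [sU3, mem_setOf_eq]; nlinarith [key]
    · simp only [sU4c, mem_setOf_eq]; nlinarith [i4]

/-- Auxiliary step `AngHSLoB_UPhi` (§19k): Ang HSLo B UPhi. [bookkeeping] -/
theorem AngHSLoB_UPhi : KZ.of AngHSLoB - KZ.of AngHUphi ∈ KZ.relations :=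
  KZ.of_sub_of_mem_relations_of_eqOn
    (by simp only [AngHSLoB, AngHUphi, KZ.IntegralRep.domain_restrict, SLoB_eq_UPhi]) (fun _ _ => rfl)
/-- Auxiliary step `AngHSLoA_RMcapD` (§19k): Ang HSLo A RMcap D. [bookkeeping] -/
theorem AngHSLoA_RMcapD : KZ.of AngHSLoA - KZ.of AngHMcapD ∈ KZ.relations :=
  KZ.of_sub_of_mem_relations_of_eqOn
    (by simp only [AngHSLoA, AngHMcapD, KZ.IntegralRep.domain_restrict, SLoA_eq_RMcapD]) (fun _ _ => rfl)

/-- **hAng4 reduced to LATTICE line polygons in one angle chart (end of g9).**  Modulo KZ-relations,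
`[AngH|RM] + [AngH|RK₊] + [AngH|RK₋] ≡ [AngH|RM⁻] + [AngH|RM_rect] + [AngH|Trap'_lo] + [AngH|Trap'_hi] + [AngH|Ũ₋']
 + [AngH|S'_hi] + [AngH|S'_lo]` — seven cells of the chart `(P, Q) = (2s, 4w − 2)`, `AngH = 8/((1+P²)(1+Q²))`, each
cut out by tangent-LINE conditions only (`RM⁻`: `1 ≤ 7P² ≤ 9, −P ≤ Q ≤ 0` (+ redundant); `RM_rect`:
`1 ≤ 7P² ≤ 9, 0 ≤ Q, 9Q² ≤ 7` (+ redundant); `Trap'_lo`: `0 ≤ Q ≤ P, 7P² ≤ 1`; `Trap'_hi`: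
`P ≤ Q ≤ 1, 7(Q−P)² ≤ (1+PQ)², 7P² ≤ 1`; `Ũ₋'`: `Q ≥ 0, 7(P+Q)² ≤ (1−PQ)², …` (+ a redundant curve bound);
`S'_hi`: `1 ≤ 7P² ≤ 9, P ≤ Q, 7Q² ≤ 9`; `S'_lo`: `1 ≤ 7P² ≤ 9, 0 ≤ Q ≤ P, 7(P−Q)² ≤ (1+PQ)², 7Q² ≤ 9`), i.e. the
angle polygons `{α₁≤φ≤θ−α₁, −φ≤ψ≤0}`, `[α₁, θ−α₁]×[0, 2α₁]`, `{0≤ψ≤φ≤α₁}`, `{0≤φ≤α₁, φ≤ψ≤φ+α₁}`,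
`{φ,ψ≥0, φ+ψ≤α₁}`, `{α₁≤φ≤ψ≤θ−α₁}`, `{α₁≤φ≤θ−α₁, φ−α₁≤ψ≤φ}` — ALL with vertices in the lattice `ℤα₁ + ℤθ`
(`tan` of every lattice angle lies in `ℚ/√7 ∪ {∞}`), of total area `θ² − 2α₁²`.  What is left of `hAng4` for g10 is
rational polygon algebra (NODE §9.23). -/

theorem hAng4_polygons :
    KZ.of AngHM + KZ.of AngHp + KZ.of AngHm
      - KZ.of AngHMneg - KZ.of AngHMrect - KZ.of AngHTrapLo - KZ.of AngHTrapHi - KZ.of AngHUmr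
      - KZ.of AngHSHi - KZ.of AngHSLo ∈ KZ.relations := by
  have h := sub_mem (sub_mem (sub_mem hAng4_cells2 AngHSLo_cut) AngHSLoB_UPhi) AngHSLoA_RMcapD
  convert h using 1
  abel

/-- **hAng4 ⟸ lattice polygon algebra (end of g9).**  The hypothesis `hAng4` of `pair18_g8strips_of_grid`
(file `Pair18Homotopy.lean` v14, same namespace, same verbatim definitions) follows from the single polygon identity
`[RM⁻] + [RM_rect] + [Trap'_lo] + [Trap'_hi] + [Ũ₋'] + [S'_hi] + [S'_lo] ≡ [Th7] − 2·[B17]` for the weight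
`AngH = dφ dψ` (areas, `β := θ − 2α₁`: `(α₁β + β²/2) + 2α₁β + α₁²/2 + α₁² + α₁²/2 + β²/2 + α₁β = θ² − 2α₁²`;
recipe NODE §9.23: reflect `RM⁻`, shear `Trap'_hi`, `Ũ₋'`, `S'_lo`, swap `S'_hi`, cut at `ψ = α₁` — all RATIONAL in
this chart — then four algebraic `1/√7`-scalings to the `B17` chart). -/
theorem hAng4_of_polygons
    (hPoly : KZ.of AngHMneg + KZ.of AngHMrect + KZ.of AngHTrapLo + KZ.of AngHTrapHi + KZ.of AngHUmr
      + KZ.of AngHSHi + KZ.of AngHSLo - KZ.of Th7.rep + 2 • KZ.of B17.rep ∈ KZ.relations) :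
    KZ.of AngHM + KZ.of AngHp + KZ.of AngHm - KZ.of Th7.rep + 2 • KZ.of B17.rep ∈ KZ.relations := by
  have h := add_mem hAng4_polygons hPoly
  convert h using 1
  abel

/-! ### §19l  hAng4 bookkeeping, rational moves in the `(s,w)` chart: reflect `RM⁻`, cut the fan at `ψ = α₁`,
and glue `S'_hi` to its mirror image into the lattice square `[α₁, θ−α₁]²`

`RM⁻ = {α₁ ≤ φ ≤ θ−α₁, −φ ≤ ψ ≤ 0}` is carried by `(s,w) ↦ (s, 1−w)` (`Q ↦ −Q`, `AngH` is even in `Q`) onto the fan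
`{α₁ ≤ φ ≤ θ−α₁, 0 ≤ ψ ≤ φ}`, which the null line `7Q² = 1` (`ψ = α₁`) cuts into the rectangle
`R₀ = [α₁, θ−α₁] × [0, α₁]` and the triangle `T₂ = {α₁ ≤ ψ ≤ φ ≤ θ−α₁}`; and the square
`B = [α₁, θ−α₁]² = {1 ≤ 7P² ≤ 9, 0 ≤ Q, 1 ≤ 7Q² ≤ 9}` is cut by its diagonal into `T₂` and `S'_hi`.  Net effect on
the cell list: `[RM⁻] + [S'_hi] ≡ [R₀] + [B]`. -/

/-- the fan `{1 ≤ 7P² ≤ 9, 0 ≤ Q ≤ P}`. -/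
def Fan : Set (Fin 2 → ℝ) := cube 2 ∩ (sRM1 ∩ sRM2 ∩ sU1 ∩ sU2)
/-- Auxiliary step `isSemialgebraic_Fan` (§19l): is Semialgebraic Fan. [bookkeeping] -/
theorem isSemialgebraic_Fan : IsSemialgebraic ℚ Fan := by
  refine KZ.isSemialgebraic_cube.inter ((((?_ : IsSemialgebraic ℚ sRM1).inter ?_).inter ?_).inter ?_)
  · exact isSemialgebraic_of_le (C 1) (C 28 * X 0 * X 0) sRM1 fun z => by
      simp only [sRM1, mem_setOf_eq, map_mul, aeval_C, aeval_X, eq_ratCast, Rat.cast_ofNat, Rat.cast_one]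
  · exact isSemialgebraic_of_le (C 28 * X 0 * X 0) (C 9) sRM2 fun z => by
      simp only [sRM2, mem_setOf_eq, map_mul, aeval_C, aeval_X, eq_ratCast, Rat.cast_ofNat]
  · exact isSemialgebraic_of_le (C 2) (C 4 * X 1) sU1 fun z => by
      simp only [sU1, mem_setOf_eq, map_mul, aeval_C, aeval_X, eq_ratCast, Rat.cast_ofNat]
  · exact isSemialgebraic_of_le (C 4 * X 1 - C 2) (C 2 * X 0) sU2 fun z => by
      simp only [sU2, mem_setOf_eq, map_mul, map_sub, aeval_C, aeval_X, eq_ratCast, Rat.cast_ofNat]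
/-- Auxiliary definition `AngHFan` (§19l): Ang HFan. [bookkeeping] -/
def AngHFan : KZ.IntegralRep 2 := AngH.rep.restrict Fan isSemialgebraic_Fan (fun _ hz => hz.1)

end Fold
end Summit.KontsevichZagierPeriods.RootDecompQuadraticDescent.Pair18Homotopy
end
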